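import Mathlib.Combinatorics.SetFamily.FourFunctions
import Mathlib.Order.UpperLower.Basic
import Mathlib.Tactic
import HarnessLib
import HarnessLib.Audit.Tags
import Summits.CriticalPhenomena.PercolationContinuityZ3.Theorems.PercNearOneGluingNoHeavyLowerTailSahiColouredDaykin

/-!
# Signed coloured Daykin: the programme needs it only for CROSSING configurations (petal systems)

Support file (seat `prim-masterthm-p1`, gen 28; `--supports stmt-CriticalPhenomena-4575`).  One new `Prop` (the weakened conjecture
`CrossSignedColouredDaykin3`), no `sorry`, standard axioms.  Memo `run/shared/lean/prim/prim-masterthm/FROM-prim-masterthm-p1-g28-STRONG-DAYKIN.md` §16.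

CONTEXT.  Gen 27 (`…SahiColouredDaykin`) reduced the three-petal refined antipodal Gladkov count (G_JM-comb, the comb form of
`e₂ ≤ μ(J₂)μ(M₂)`) to the typed conjecture `SignedColouredDaykin3` (SCD₃): for EVERY family `P ⊆ 2^F` without a complementary pair and every
3-colouring, `#P ≤ #(compatJoins F P c)`.  SCD₃ is tight on large "islands" and has resisted every attack (memo §3–§15).  The point of this file:
**the reduction only ever applies SCD₃ to configurations derived from a 3-petal SYSTEM** — three up-sets `U₀, U₁, U₂` with all pairwise
intersections equal to a common kernel `K`, petals `C_i = U_i \ K` — and such configurations are very special: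

* `not_subset_of_mem_petal` — in a petal system no member of one petal is contained in a member of another petal (if `x ⊆ y`, `x ∈ U_i`,
  then `y ∈ U_i ∩ U_j = K`).  Consequently (`cross_of_mem_crossPairs₃`, inside the proof of the reduction) the derived configuration
  `P = crossPairs₃ C B F` with its cyclic colouring is **CROSSING**: any two members meet and do not cover `F`, and members of different colours
  are incomparable.
* `CrossSignedColouredDaykin3` — SCD₃ restricted to crossing configurations (literally weaker: `crossSignedColouredDaykin3_of_signedColouredDaykin3`).
* `card_crossPairs₃_le_card_payPairs₃_of_cross` — **`CrossSignedColouredDaykin3 ⟹ (G_JM-comb)` for the petals of every 3-petal system of up-sets,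
  in every sub-cube** (the prism lemma of gen 27, verbatim, plus the crossing of the derived configuration).

EVIDENCE for `CrossSignedColouredDaykin3` (engines `code-g28/cross*.c`, memo §16): complete enumeration of all three-colour crossing configurations
of `2^4` (48; all have `|P| = 3` and slack 2), `2^5` (10 320; `|P| ≤ 6`, slack ≥ 2) and `2^6` (447 151 200; `|P| ≤ 13`, slack ≥ 1, NONE tight) —
so the refined count holds for every 3-petal system on `2^n`, `n ≤ 6`; an explicit family (`F = B₀⊔B₁⊔B₂`, `P_c = {B_c ∪ X : ∅ ≠ X ⊊ B_{c+1}}`)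
has slack exactly 1 for all `|B_i| = b`.  Domination (`…SahiColouredDaykinDominated`) never applies here (`S ∪ T = F`, `S ∩ T = ∅` are excluded) —
the two partial results cover opposite regimes.  HONEST FRAMING: a reduction and a sharper conjecture; the conjecture stays OPEN. [this work]
-/

namespace Summit.CriticalPhenomena.PercolationContinuityZ3.Theorems.SahiColouredDaykin

open Finset
open scoped FinsetFamily

variable {α : Type*} [DecidableEq α]

/-! ### 1. The crossing form of the conjecture -/

/-- **CONJECTURE (signed coloured Daykin for CROSSING configurations).**  For `P ⊆ 2^F` with a 3-colouring such that any two members meet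
and do not cover `F`, and members of different colours are incomparable, the compatible unions are at least as numerous as `P`.
Weaker than `SignedColouredDaykin3`; it is all the three-petal reduction needs (`card_crossPairs₃_le_card_payPairs₃_of_cross`).  Verified by
complete enumeration on `2^n`, `n ≤ 6` (never tight for three colours). [this work] [status: open] -/
@[conjecture] def CrossSignedColouredDaykin3 (α : Type*) [DecidableEq α] : Prop :=
  ∀ (F : Finset α) (P : Finset (Finset α)) (c : Finset α → Fin 3),
    (∀ S ∈ P, S ⊆ F) →
    (∀ S ∈ P, ∀ T ∈ P, c S ≠ c T → ¬ S ⊆ T) →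
    (∀ S ∈ P, ∀ T ∈ P, (S ∩ T).Nonempty ∧ S ∪ T ≠ F) →
    #P ≤ #(compatJoins F P c)

/-- The crossing form is (trivially) implied by the full conjecture: a crossing configuration has no complementary pair. [this work] -/
theorem crossSignedColouredDaykin3_of_signedColouredDaykin3 (h : SignedColouredDaykin3 α) : CrossSignedColouredDaykin3 α := by
  intro F P c hPF _ hcross
  refine h F P c hPF ?_
  intro S hS hS'
  have hne := (hcross S hS (F \ S) hS').1
  rw [inter_sdiff_self] at hne
  exact Finset.not_nonempty_empty hne

/-! ### 2. Petal systems: no containment across petals -/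

/-- **No containment across petals.**  If `U_i, U_j` are up-sets with `U_i ∩ U_j = K` (`i ≠ j`), then no member of the petal `U_i \ K` is
contained in a member of the petal `U_j \ K`. [this work] -/
theorem not_subset_of_mem_petal {ι : Type*} {U : ι → Finset (Finset α)} {K : Finset (Finset α)}
    (hU : ∀ i, IsUpperSet (U i : Set (Finset α))) (hK : ∀ i j, i ≠ j → U i ∩ U j = K)
    {i j : ι} (hij : i ≠ j) {x y : Finset α} (hx : x ∈ U i \ K) (hy : y ∈ U j \ K) : ¬ x ⊆ y := by
  intro hxy
  obtain ⟨hxi, _⟩ := mem_sdiff.1 hx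
  obtain ⟨hyj, hyK⟩ := mem_sdiff.1 hy
  have hyi : y ∈ U i := by
    have := hU i (show x ≤ y from hxy) (mem_coe.2 hxi)
    exact mem_coe.1 this
  have : y ∈ U i ∩ U j := mem_inter.2 ⟨hyi, hyj⟩
  rw [hK i j hij] at this
  exact hyK this

/-- Petals of a petal system are pairwise disjoint. [this work] -/
theorem disjoint_petals {ι : Type*} {U : ι → Finset (Finset α)} {K : Finset (Finset α)}
    (hK : ∀ i j, i ≠ j → U i ∩ U j = K) {i j : ι} (hij : i ≠ j) : Disjoint (U i \ K) (U j \ K) := by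
  rw [disjoint_left]
  intro x hx hx'
  obtain ⟨hxi, hxK⟩ := mem_sdiff.1 hx
  obtain ⟨hxj, _⟩ := mem_sdiff.1 hx'
  have : x ∈ U i ∩ U j := mem_inter.2 ⟨hxi, hxj⟩
  rw [hK i j hij] at this
  exact hxK this

/-! ### 3. Small tools (copies of the private helpers of `…SahiColouredDaykin`) -/

/-- `(B ∪ S) ∪ (B ∪ T) = B ∪ (S ∪ T)`. [folklore] -/
private theorem union_union_eq' (B S T : Finset α) : (B ∪ S) ∪ (B ∪ T) = B ∪ (S ∪ T) := by
  ext a; simp only [mem_union]; tauto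

/-- `(B ∪ S) ∩ (B ∪ T) = B ∪ (S ∩ T)`. [folklore] -/
private theorem union_inter_eq' (B S T : Finset α) : (B ∪ S) ∩ (B ∪ T) = B ∪ (S ∩ T) := by
  ext a; simp only [mem_union, mem_inter]; tauto

/-- `F ∖ (S ∪ T) = (F ∖ S) ∩ (F ∖ T)`. [folklore] -/
private theorem sdiff_union_eq' (F S T : Finset α) : F \ (S ∪ T) = (F \ S) ∩ (F \ T) := by
  ext a; simp only [mem_sdiff, mem_union, mem_inter]; tauto

/-- For `S' ⊆ F`: `F ∖ (S ∪ (F ∖ S')) = (F ∖ S) ∩ S'`. [folklore] -/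
private theorem sdiff_union_sdiff_eq' {F S S' : Finset α} (hS' : S' ⊆ F) : F \ (S ∪ (F \ S')) = (F \ S) ∩ S' := by
  ext a
  have haF : a ∈ S' → a ∈ F := fun h => hS' h
  simp only [mem_sdiff, mem_union, mem_inter]
  tauto

/-- For `S, S' ⊆ F`: `F ∖ ((F ∖ S) ∪ (F ∖ S')) = S ∩ S'`. [folklore] -/
private theorem sdiff_sdiff_union_sdiff_eq' {F S S' : Finset α} (hS : S ⊆ F) (hS' : S' ⊆ F) :
    F \ ((F \ S) ∪ (F \ S')) = S ∩ S' := by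
  ext a
  have h1 : a ∈ S → a ∈ F := fun h => hS h
  have h2 : a ∈ S' → a ∈ F := fun h => hS' h
  simp only [mem_sdiff, mem_union, mem_inter]
  tauto

/-- In `Fin 3`, `i ≠ i + 1`. [folklore] -/
private theorem fin3_ne_add_one' (i : Fin 3) : i ≠ i + 1 := by
  fin_cases i <;> decide

/-- In `Fin 3`, `i ≠ i + 2`. [folklore] -/
private theorem fin3_ne_add_two' (i : Fin 3) : i ≠ i + 1 + 1 := by
  fin_cases i <;> decide

/-- `i ↦ i + 1` is injective on `Fin 3`. [folklore] -/
private theorem fin3_add_one_injective' {i j : Fin 3} (h : i + 1 = j + 1) : i = j := by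
  fin_cases i <;> fin_cases j <;> first | rfl | (exfalso; revert h; decide)

/-- The petal index ("tail") of a configuration, for pairwise disjoint petals. [this work] -/
private def tail' (C : Fin 3 → Finset (Finset α)) (x : Finset α) : Fin 3 :=
  if x ∈ C 0 then 0 else if x ∈ C 1 then 1 else 2

/-- For pairwise disjoint petals, `tail' C x = i` whenever `x ∈ C i`. [this work] -/
private theorem tail'_eq_of_mem {C : Fin 3 → Finset (Finset α)} (hC : ∀ i j : Fin 3, i ≠ j → Disjoint (C i) (C j))
    {x : Finset α} {i : Fin 3} (hx : x ∈ C i) : tail' C x = i := by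
  have key : ∀ j : Fin 3, j ≠ i → x ∉ C j := fun j hj hxj => (disjoint_left.1 (hC j i hj) hxj) hx
  unfold tail'
  split_ifs with h0 h1
  · by_contra hne
    exact key 0 hne h0
  · by_contra hne
    exact key 1 hne h1
  · fin_cases i
    · exact absurd hx h0
    · exact absurd hx h1
    · rfl

/-! ### 4. The reduction for petal systems -/

/-- **`CrossSignedColouredDaykin3 ⟹ (G_JM-comb)` for the three petals of a petal system, in every sub-cube.**  `U₀, U₁, U₂` are up-sets with
all pairwise intersections equal to `K`; the petals are `C_i = U_i \ K`.  The derived configuration `P = crossPairs₃ C B F` (cyclic orientation,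
colour of `S` = petal of `B ∪ S`) is crossing by `not_subset_of_mem_petal` (a containment between the relevant signed members would be a containment
across two different petals), and the prism lemma of gen 27 puts every compatible union into `payPairs₃`. [this work] -/
theorem card_crossPairs₃_le_card_payPairs₃_of_cross (h : CrossSignedColouredDaykin3 α)
    {U : Fin 3 → Finset (Finset α)} {K : Finset (Finset α)}
    (hU : ∀ i, IsUpperSet (U i : Set (Finset α))) (hK : ∀ i j, i ≠ j → U i ∩ U j = K) (B F : Finset α) :
    #(crossPairs₃ (fun i => U i \ K) B F) ≤ #(payPairs₃ (fun i => U i \ K) B F) := by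
  set C : Fin 3 → Finset (Finset α) := fun i => U i \ K with hCdef
  have hC : ∀ i j : Fin 3, i ≠ j → Disjoint (C i) (C j) := fun i j hij => disjoint_petals hK hij
  -- no containment across petals, in the form used below
  have ncont : ∀ {i j : Fin 3}, i ≠ j → ∀ {x y : Finset α}, x ∈ C i → y ∈ C j → ¬ x ⊆ y :=
    fun {i j} hij {x y} hx hy => not_subset_of_mem_petal hU hK hij hx hy
  set P := crossPairs₃ C B F with hP
  set c : Finset α → Fin 3 := fun S => tail' C (B ∪ S) with hc
  -- unpacking membership in `P`
  have memP : ∀ {S}, S ∈ P → S ⊆ F ∧ B ∪ S ∈ C (c S) ∧ B ∪ (F \ S) ∈ C (c S + 1) := by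
    intro S hS
    obtain ⟨hSF, i, h1, h2⟩ := mem_filter.1 hS
    have hi : c S = i := tail'_eq_of_mem hC h1
    refine ⟨mem_powerset.1 hSF, ?_, ?_⟩
    · rw [hi]; exact h1
    · rw [hi]; exact h2
  have memPay : ∀ {T}, T ⊆ F → B ∪ T ∈ crossJoins₃ C → B ∪ (F \ T) ∈ crossMeets₃ C → T ∈ payPairs₃ C B F :=
    fun {T} hT h1 h2 => mem_filter.2 ⟨mem_powerset.2 hT, h1, h2⟩
  -- hypotheses of the crossing conjecture
  have hPF : ∀ S ∈ P, S ⊆ F := fun S hS => (memP hS).1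
  have hinc : ∀ S ∈ P, ∀ T ∈ P, c S ≠ c T → ¬ S ⊆ T := by
    intro S hS T hT hne hST
    obtain ⟨_, hS1, _⟩ := memP hS
    obtain ⟨_, hT1, _⟩ := memP hT
    exact ncont hne hS1 hT1 (union_subset_union (Subset.refl B) hST)
  have hcross : ∀ S ∈ P, ∀ T ∈ P, (S ∩ T).Nonempty ∧ S ∪ T ≠ F := by
    intro S hS T hT
    obtain ⟨hSF, hS1, hS2⟩ := memP hS
    obtain ⟨hTF, hT1, hT2⟩ := memP hT
    constructor
    · -- if `S ∩ T = ∅` then `S ⊆ F \ T` and `T ⊆ F \ S`: two containments, one of them across different petals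
      rw [nonempty_iff_ne_empty]
      intro hdis
      have hS_sub : S ⊆ F \ T := by
        intro x hx
        refine mem_sdiff.2 ⟨hSF hx, fun hxT => ?_⟩
        have : x ∈ S ∩ T := mem_inter.2 ⟨hx, hxT⟩
        rw [hdis] at this
        exact absurd this (notMem_empty x)
      have hT_sub : T ⊆ F \ S := by
        intro x hx
        refine mem_sdiff.2 ⟨hTF hx, fun hxS => ?_⟩
        have : x ∈ S ∩ T := mem_inter.2 ⟨hxS, hx⟩
        rw [hdis] at this
        exact absurd this (notMem_empty x)
      by_cases e : c S = c T + 1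
      · have hne : c T ≠ c S + 1 := by
          rw [e]; exact fin3_ne_add_two' (c T)
        exact ncont hne hT1 hS2 (union_subset_union (Subset.refl B) hT_sub)
      · exact ncont e hS1 hT2 (union_subset_union (Subset.refl B) hS_sub)
    · -- if `S ∪ T = F` then `F \ S ⊆ T` and `F \ T ⊆ S`
      intro hcov
      have h1 : F \ S ⊆ T := by
        intro x hx
        obtain ⟨hxF, hxS⟩ := mem_sdiff.1 hx
        have : x ∈ S ∪ T := by rw [hcov]; exact hxF
        exact (mem_union.1 this).resolve_left hxS
      have h2 : F \ T ⊆ S := by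
        intro x hx
        obtain ⟨hxF, hxT⟩ := mem_sdiff.1 hx
        have : x ∈ S ∪ T := by rw [hcov]; exact hxF
        exact (mem_union.1 this).resolve_right hxT
      by_cases e : c S + 1 = c T
      · have hne : c T + 1 ≠ c S := by
          rw [← e]; exact (fin3_ne_add_two' (c S)).symm
        exact ncont hne hT2 hS1 (union_subset_union (Subset.refl B) h2)
      · exact ncont e hS2 hT1 (union_subset_union (Subset.refl B) h1)
  -- compatible unions are pay pairs (prism lemma, as in gen 27)
  have hsub : compatJoins F P c ⊆ payPairs₃ C B F := by
    intro T hT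
    rcases mem_union.1 hT with hT | hT
    · rcases mem_union.1 hT with hT | hT
      · -- positive–positive, different colours
        obtain ⟨⟨S, S'⟩, hSS', rfl⟩ := mem_image.1 hT
        obtain ⟨hmem, hne⟩ := mem_filter.1 hSS'
        obtain ⟨hS, hS'⟩ := mem_product.1 hmem
        obtain ⟨hSF, hS1, hS2⟩ := memP hS
        obtain ⟨hS'F, hS'1, hS'2⟩ := memP hS'
        have hne' : c S + 1 ≠ c S' + 1 := fun e => hne (fin3_add_one_injective' e)
        refine memPay (union_subset hSF hS'F) ?_ ?_
        · rw [← union_union_eq']; exact union_mem_crossJoins₃ hne hS1 hS'1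
        · rw [sdiff_union_eq', ← union_inter_eq']; exact inter_mem_crossMeets₃ hne' hS2 hS'2
      · -- negative–negative, different colours
        obtain ⟨⟨S, S'⟩, hSS', rfl⟩ := mem_image.1 hT
        obtain ⟨hmem, hne⟩ := mem_filter.1 hSS'
        obtain ⟨hS, hS'⟩ := mem_product.1 hmem
        obtain ⟨hSF, hS1, hS2⟩ := memP hS
        obtain ⟨hS'F, hS'1, hS'2⟩ := memP hS'
        have hne' : c S + 1 ≠ c S' + 1 := fun e => hne (fin3_add_one_injective' e)
        refine memPay (union_subset sdiff_subset sdiff_subset) ?_ ?_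
        · rw [← union_union_eq']; exact union_mem_crossJoins₃ hne' hS2 hS'2
        · rw [sdiff_sdiff_union_sdiff_eq' hSF hS'F, ← union_inter_eq']; exact inter_mem_crossMeets₃ hne hS1 hS'1
    · -- positive–negative, same colour
      obtain ⟨⟨S, S'⟩, hSS', rfl⟩ := mem_image.1 hT
      obtain ⟨hmem, heq⟩ := mem_filter.1 hSS'
      obtain ⟨hS, hS'⟩ := mem_product.1 hmem
      obtain ⟨hSF, hS1, hS2⟩ := memP hS
      obtain ⟨hS'F, hS'1, hS'2⟩ := memP hS'
      have h12 : c S ≠ c S' + 1 := by rw [heq]; exact fin3_ne_add_one' (c S')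
      have h21 : c S + 1 ≠ c S' := by rw [heq]; exact (fin3_ne_add_one' (c S')).symm
      refine memPay (union_subset hSF sdiff_subset) ?_ ?_
      · rw [← union_union_eq']; exact union_mem_crossJoins₃ h12 hS1 hS'2
      · rw [sdiff_union_sdiff_eq' hS'F, ← union_inter_eq']; exact inter_mem_crossMeets₃ h21 hS2 hS'1
  exact (h F P c hPF hinc hcross).trans (card_le_card hsub)

end Summit.CriticalPhenomena.PercolationContinuityZ3.Theorems.SahiColouredDaykin
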